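import Summits.QuantumFields.YangMills.Theorems.BalabanLadderUVSeamRecTorusOneLoopFloor
import Summits.QuantumFields.YangMills.Theorems.BalabanLadderUVSeamRecTorusCeilingPinning
import Summits.QuantumFields.YangMills.Theorems.BalabanLadderUVSeamRecColdWallCentreOfExtremal
import HarnessLib

/-!
# Crux `UVSeamRec` (stmt-QuantumFields-20043): the (RM) reference is pinned FROM BELOW AT THE ONE-LOOP VALUE `2 − p(β) ≥ 3/(4β) − o(1/β)`

Helper file (`--supports stmt-QuantumFields-20043`) of the LEAD seat `ym-spine-20043-p1` (gen 15), sequel of `…TorusOneLoopFloor` (the volume-uniform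
one-loop floor of the torus plaquette deficit, `β·torusE(2 − plane q x) ≥ 3/4 − 3β^{−θ}` eventually in the torus size) and of gen 11's
`…TorusCeilingPinning` (`2 − p q β ∈ [6/(24β+3) − C₁(e^B−1)/R⁴, 29/β + C₁(e^B−1)/R⁴]` for EVERY witness of the (RM) binder).  The skeleton of record
`Lines/coldwall_pure.lean` proves the registered v5(α) text `stub_responseMomentsOdd6` (binder (RM), reference `p` ∃-quantified) from its stubs; the
instrument rows of the line compare measured plaquette means with `p`.  Here:
* **`responseMoments_two_sub_ref_ge_threeQuarters`** — under the (RM) binder (seam-s2's `hRM` VERBATIM), for `0 < θ ≤ θ₀` and `β ≥ β₀(θ)`, `β ≥ β₁`,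
  `1 ≤ R`, `R·a β ≤ ℓ₁`, `q.1 < q.2`:  `3/(4β) − 3β^{−1−θ} − C₁(e^B − 1)/R⁴ ≤ 2 − p q β` — the LOWER pin of the (RM) reference is the perturbative
  one-loop value (gen 10/11: `6/(24β+3) ≈ 1/(4β)`), via `ResponsePinning.abs_torusE_plane_sub_le_of_responseMoments` on a large admissible torus;
* `responseMoments_two_sub_ref_mem_Icc_threeQuarters` — the two-sided pin `2 − p q β ∈ [3/(4β) − 3β^{−1−θ} − tol, 29/β + tol]`, `tol = C₁(e^B−1)/R⁴`;
* `responseMomentsOdd6SU2_body_ref_ge_threeQuarters` — the same read on the body of the registered `stub_responseMomentsOdd6`.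
HONEST FRAMING: necessary conditions on the ∃-witness of an OPEN registered statement; the matching one-loop UPPER pin (`≤ 3/(4β) + o(1/β)`) would need the
torus one-loop CEILING (the route `WeakCouplingRates`' BULK side) and is NOT claimed; nothing of E0′, NT or the gap; YM mass gap NOT proved; not Clay.
-/

set_option autoImplicit false

noncomputable section

open MeasureTheory Filter Topology
open Literature.MathematicalPhysics.QuantumLattice (fundamentalLatticeRep LGConfig)
open Summit.QuantumFields.YangMills.Cruxes.OSLegsFromFemtoAndGap.DlrCollarTransfer
open Summit.QuantumFields.YangMills.Cruxes.UVSeamRec.ResponsePinning (abs_torusE_plane_sub_le_of_responseMoments)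
open Summit.QuantumFields.YangMills.Cruxes.UVSeamRec.ClassicalResponse.ThermalFloor (responseMoments_ref_ge_sharp)

namespace Summit.QuantumFields.YangMills.Cruxes.UVSeamRec.ClassicalResponse.ColdWall

/-- **THE (RM) REFERENCE IS PINNED FROM BELOW AT ONE LOOP.**  There is `θ₀ ∈ (0, 1/100]` such that for all `0 < θ ≤ θ₀` there is `β₀` with: under
seam-s2's `hRM` binder (constants `C₁ > 0, B, β₁, ℓ₁`, unit `a`, reference `p`), for `β ≥ β₀`, `β ≥ β₁`, `1 ≤ R`, `R·a β ≤ ℓ₁`, `q.1 < q.2`: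
`3/(4β) − 3β^{−1−θ} − C₁(e^B − 1)/R⁴ ≤ 2 − p q β`. [folklore] -/
theorem responseMoments_two_sub_ref_ge_threeQuarters :
    ∃ θ₀ : ℝ, 0 < θ₀ ∧ θ₀ ≤ 1 / 100 ∧ ∀ θ : ℝ, 0 < θ → θ ≤ θ₀ → ∃ β₀ : ℝ, 0 < β₀ ∧ ∀ (a : ℝ → ℝ) (C₁ B β₁ ℓ₁ : ℝ)
      (p : Fin 4 × Fin 4 → ℝ → ℝ), 0 < C₁ →
      (∀ β : ℝ, β₁ ≤ β → ∀ (L n : ℕ) (q : Fin n → Fin 4 × Fin 4) (x : Fin n → (Fin 4 → ℤ)) (R : ℕ),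
        (∀ i, (q i).1 < (q i).2) → 1 ≤ R → (R : ℝ) * a β ≤ ℓ₁ → 4 * R + 8 ≤ L →
        (∀ i j : Fin n, i ≠ j → ∃ k : Fin 4,
          (2 * (R : ℤ) + 4) ≤ |((((x i k - x j k : ℤ) : ZMod (2 * L + 1))).valMinAbs : ℤ)|) →
        ∀ T : Finset (Fin n),
          torusE (Matrix.specialUnitaryGroup (Fin 2) ℂ) (fundamentalLatticeRep 2) β L
            (fun U => Real.exp (∑ i ∈ T, (R : ℝ) ^ 4 / C₁ *
              |kerE (Matrix.specialUnitaryGroup (Fin 2) ℂ) (fundamentalLatticeRep 2) β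
                (fun k => x i k - (R + 1)) (2 * R + 3) U
                (plane (Matrix.specialUnitaryGroup (Fin 2) ℂ) (fundamentalLatticeRep 2) (q i) (x i)) -
                p (q i) β|)) ≤ Real.exp (B * T.card)) →
      ∀ β : ℝ, β₀ ≤ β → β₁ ≤ β → ∀ R : ℕ, 1 ≤ R → (R : ℝ) * a β ≤ ℓ₁ → ∀ q : Fin 4 × Fin 4, q.1 < q.2 →
        3 / (4 * β) - 3 * β ^ (-1 - θ) - C₁ * (Real.exp B - 1) / (R : ℝ) ^ 4 ≤ 2 - p q β := by
  obtain ⟨θ₀, hθ₀, hθ₀', hA⟩ := torusE_two_sub_plane_ge_threeQuarters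
  refine ⟨θ₀, hθ₀, hθ₀', fun θ hθ hθle => ?_⟩
  obtain ⟨β₀, hβ₀⟩ := hA θ hθ hθle
  refine ⟨max β₀ 1, lt_of_lt_of_le one_pos (le_max_right _ _), fun a C₁ B β₁ ℓ₁ p hC₁ hRM β hβ hβ1' R hR hRa q hq => ?_⟩
  have hb0 : β₀ ≤ β := (le_max_left _ _).trans hβ
  have hβ1 : (1 : ℝ) ≤ β := (le_max_right _ _).trans hβ
  have hβ0 : 0 < β := by linarith
  -- a large admissible torus: the floor eventually in `L`, and `4R + 8 ≤ L`
  obtain ⟨L, hL⟩ := ((hβ₀ β hb0).and (eventually_ge_atTop (4 * R + 8))).exists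
  obtain ⟨hfloor, hL4⟩ := hL
  have h1 := abs_torusE_plane_sub_le_of_responseMoments (fundamentalLatticeRep 2) a hC₁ hRM hβ1' (L := L) q 0 hq hR hRa hL4
  have h2 := hfloor q 0 hq
  rw [torusE_const_sub (Matrix.specialUnitaryGroup (Fin 2) ℂ) (fundamentalLatticeRep 2) β L
    (continuous_plane (fundamentalLatticeRep 2) q 0) 2] at h2
  have h3 := (abs_le.1 h1).1
  have hβθ : β ^ (-1 - θ) = β ^ (-θ) / β := by rw [show -1 - θ = -θ - 1 by ring, Real.rpow_sub_one hβ0.ne']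
  rw [hβθ]
  generalize hTdef : torusE (Matrix.specialUnitaryGroup (Fin 2) ℂ) (fundamentalLatticeRep 2) β L
    (plane (Matrix.specialUnitaryGroup (Fin 2) ℂ) (fundamentalLatticeRep 2) q 0) = T at h2 h3
  have key : 3 / (4 * β) - 3 * (β ^ (-θ) / β) ≤ 2 - T := by
    rw [show 3 / (4 * β) - 3 * (β ^ (-θ) / β) = (3 / 4 - 3 * β ^ (-θ)) / β by field_simp, div_le_iff₀ hβ0]
    linarith
  linarith

/-- **Two-sided pin of the (RM) reference with the one-loop floor**: under the `hRM` binder, for `0 < θ ≤ θ₀`, `β ≥ β₀(θ)`, `β ≥ β₁`, `β ≥ 2`, `1 ≤ R`,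
`R·a β ≤ ℓ₁`, `q.1 < q.2`:  `2 − p q β ∈ [3/(4β) − 3β^{−1−θ} − C₁(e^B−1)/R⁴, 29/β + C₁(e^B−1)/R⁴]`. [folklore] -/
theorem responseMoments_two_sub_ref_mem_Icc_threeQuarters :
    ∃ θ₀ : ℝ, 0 < θ₀ ∧ θ₀ ≤ 1 / 100 ∧ ∀ θ : ℝ, 0 < θ → θ ≤ θ₀ → ∃ β₀ : ℝ, 0 < β₀ ∧ ∀ (a : ℝ → ℝ) (C₁ B β₁ ℓ₁ : ℝ)
      (p : Fin 4 × Fin 4 → ℝ → ℝ), 0 < C₁ →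
      (∀ β : ℝ, β₁ ≤ β → ∀ (L n : ℕ) (q : Fin n → Fin 4 × Fin 4) (x : Fin n → (Fin 4 → ℤ)) (R : ℕ),
        (∀ i, (q i).1 < (q i).2) → 1 ≤ R → (R : ℝ) * a β ≤ ℓ₁ → 4 * R + 8 ≤ L →
        (∀ i j : Fin n, i ≠ j → ∃ k : Fin 4,
          (2 * (R : ℤ) + 4) ≤ |((((x i k - x j k : ℤ) : ZMod (2 * L + 1))).valMinAbs : ℤ)|) →
        ∀ T : Finset (Fin n),
          torusE (Matrix.specialUnitaryGroup (Fin 2) ℂ) (fundamentalLatticeRep 2) β L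
            (fun U => Real.exp (∑ i ∈ T, (R : ℝ) ^ 4 / C₁ *
              |kerE (Matrix.specialUnitaryGroup (Fin 2) ℂ) (fundamentalLatticeRep 2) β
                (fun k => x i k - (R + 1)) (2 * R + 3) U
                (plane (Matrix.specialUnitaryGroup (Fin 2) ℂ) (fundamentalLatticeRep 2) (q i) (x i)) -
                p (q i) β|)) ≤ Real.exp (B * T.card)) →
      ∀ β : ℝ, β₀ ≤ β → β₁ ≤ β → 2 ≤ β → ∀ R : ℕ, 1 ≤ R → (R : ℝ) * a β ≤ ℓ₁ → ∀ q : Fin 4 × Fin 4, q.1 < q.2 →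
        2 - p q β ∈ Set.Icc (3 / (4 * β) - 3 * β ^ (-1 - θ) - C₁ * (Real.exp B - 1) / (R : ℝ) ^ 4)
          (29 / β + C₁ * (Real.exp B - 1) / (R : ℝ) ^ 4) := by
  obtain ⟨θ₀, hθ₀, hθ₀', hA⟩ := responseMoments_two_sub_ref_ge_threeQuarters
  refine ⟨θ₀, hθ₀, hθ₀', fun θ hθ hθle => ?_⟩
  obtain ⟨β₀, hβ₀, h⟩ := hA θ hθ hθle
  refine ⟨β₀, hβ₀, fun a C₁ B β₁ ℓ₁ p hC₁ hRM β hβ hβ1 hβ2 R hR hRa q hq => ⟨h a C₁ B β₁ ℓ₁ p hC₁ hRM β hβ hβ1 R hR hRa q hq, ?_⟩⟩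
  have h2 := responseMoments_ref_ge_sharp a hC₁ hRM hβ1 hβ2 hR hRa q hq
  linarith

end Summit.QuantumFields.YangMills.Cruxes.UVSeamRec.ClassicalResponse.ColdWall

end
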